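import Summits.Ventures.Crystal3D.Theorems.StickyWulffConstantCoaxialWallLawThinWallFibre
import Summits.Ventures.Crystal3D.Theorems.StickyWulffConstantCoaxialWallLawCreditLedger
import Summits.Ventures.Crystal3D.Theorems.StickyWulffConstantCoaxialWallLawNetRung
import HarnessLib

/-!
# The thin-wall law: a residual-free vicinal wall law for ARBITRARY fillings of every co-axial pair, at each thickness

HONEST FRAMING. Part of the venture `Summits/Ventures/Crystal3D` (cell `crystal3d-full`), helper
`--supports` the crux `CoaxialWallLaw` (stmt-Ventures-19481, `route-Ventures-StickyWulffConstant`),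
REGISTERED line `WallLedgerF` (planner cf-p1 gen 16), stub `stub_coaxialTwoSlabAdhesion`.  The residual
`#FTC` (foreign-twin-capped in-plane exits) of this seat's co-axial general-filling rungs is PAID here at
finite thickness: each such exit is joined, down its coherent (non-horizontal) plate, to an unsaturated ball
within `O(1+h)` steps (`twinDozen_plateFoot_payer`), and at most `O(1+h)` exits share a foot
(`card_le_of_foot_map_sep`).  Inputs `KissingGap δ`, `KissingClassification δ` BY NAME only (tree theorems at
`δ = 5/2`, computational grade).  Rung credit only; F-C1 not moved.

**Theorem (`coaxialTwoSlabAdhesion_thinWall`).**  `Λ₁ = A₁·Λ₀ + t₁` co-axial with the frame `L` (crux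
hypothesis for grain 1), VICINAL regime `sin θ = √(1 − ⟪L e₃, e₃⟫²) ≤ 2/5`, `Λ₂ ≠ Λ₁` ANY second grain.  Then
there are `C` and `R₀ = 10` such that in EVERY cell of `CoaxialTwoSlabAdhesion` (ARBITRARY unit-separated
filling; nothing else assumed):

  `cross(P₁, X∖P₁) + cross(P₂, Y) ≤ D(Y) + (φ₁ + φ₂ − sin θ / (250000·(1 + h))) π ρ² + C (1 + h) ρ`.

NO residual, NO certificate: every wall of thickness `h` between a vicinal co-axial grain and any other grain
costs at least `sin θ·πρ²/(250000(1+h))` beyond the two outer faces, whatever the filling; the charge decays like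
`1/(1+h)` (a plate foot is shared by the `O(1+h)` exits of its plate), so this is NOT the stub — it says that a
counterexample family to the stub must use structures of unbounded height.

Assembly: credit ledger (`interior_ledger_ge_faces_add_unsaturated`; credited = payer near an inner located
in-plane exit OR plate foot); `#EX_in ≤ #FTC_in + 1885·#payers` (`card_exits_le_restrict`); `#FTC_in ≤
1872(K+1)·#feet` (`K = ⌈3(h+23)⌉`, descent rate `1/3`); `#EX_in ≥ flux·π(ρ−1)² − O((1+h)Kρ)` (annulus of width
`K` by `card_mul_le_of_separated_in_shell`); flux `≥ (√6/2) sin θ`; small cells (`ρ < K + 4`) absorbed in `C(1+h)ρ`.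

WHAT THIS IS NOT: not the stub (charge `∝ 1/(1+h)`, regime `sin θ ≤ 2/5`); F-C1 not moved. -/

noncomputable section

namespace Summit.Ventures.Crystal3D.Theorems

open Summit.Ventures.Crystal3D Finset
open Literature.MathematicalPhysics.StatisticalMechanics (fccStacking barlowStacking IsHaggSeq contactDeficiency)
open scoped InnerProductSpace

open scoped Classical in
/-- **The thin-wall law.**  See the module docstring. -/
theorem coaxialTwoSlabAdhesion_thinWall {δ : ℝ} (hg : KissingGap δ) (hc : KissingClassification δ)
    (A₁ : EuclideanSpace ℝ (Fin 3) ≃ₗᵢ[ℝ] EuclideanSpace ℝ (Fin 3)) (t₁ : EuclideanSpace ℝ (Fin 3))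
    (A₂ : EuclideanSpace ℝ (Fin 3) ≃ₗᵢ[ℝ] EuclideanSpace ℝ (Fin 3)) (t₂ : EuclideanSpace ℝ (Fin 3))
    (L : EuclideanSpace ℝ (Fin 3) ≃ₗᵢ[ℝ] EuclideanSpace ℝ (Fin 3)) (s₁ : EuclideanSpace ℝ (Fin 3))
    {σ : ℤ → ℤ} (hσ : IsHaggSeq σ)
    (hsub₁ : (fun p => A₁ p + t₁) '' fccStacking 1 (Real.sqrt (2 / 3)) ⊆
      (fun p => L p + s₁) '' barlowStacking 1 (Real.sqrt (2 / 3)) σ)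
    (hne : (fun p => A₁ p + t₁) '' fccStacking 1 (Real.sqrt (2 / 3)) ≠
      (fun p => A₂ p + t₂) '' fccStacking 1 (Real.sqrt (2 / 3)))
    (hvic : Real.sqrt (1 - ⟪L (EuclideanSpace.single (2 : Fin 3) (1 : ℝ)),
      EuclideanSpace.single (2 : Fin 3) (1 : ℝ)⟫_ℝ ^ 2) ≤ 2 / 5) :
    ∃ C R₀ : ℝ, 1 ≤ R₀ ∧ ∀ h : ℝ, 0 ≤ h → ∀ ρ : ℝ, R₀ ≤ ρ →
      ∀ X P₁ P₂ : Finset (EuclideanSpace ℝ (Fin 3)),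
      (∀ p ∈ X, ∀ q ∈ X, p ≠ q → 1 ≤ dist p q) → P₁ ⊆ X → P₂ ⊆ X \ P₁ →
      (∀ p ∈ X, -(2 * R₀) ≤ p 2 ∧ p 2 ≤ h + 2 * R₀ ∧ p 0 ^ 2 + p 1 ^ 2 ≤ ρ ^ 2) →
      (∀ p, p ∈ P₁ ↔ (p ∈ (fun q => A₁ q + t₁) '' fccStacking 1 (Real.sqrt (2 / 3)) ∧
        -(2 * R₀) ≤ p 2 ∧ p 2 ≤ -R₀ ∧ p 0 ^ 2 + p 1 ^ 2 ≤ ρ ^ 2)) →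
      (∀ p, p ∈ P₂ ↔ (p ∈ (fun q => A₂ q + t₂) '' fccStacking 1 (Real.sqrt (2 / 3)) ∧
        h + R₀ ≤ p 2 ∧ p 2 ≤ h + 2 * R₀ ∧ p 0 ^ 2 + p 1 ^ 2 ≤ ρ ^ 2)) →
      ((((P₁ ×ˢ (X \ P₁)).filter fun pq => dist pq.1 pq.2 = 1).card : ℕ) : ℝ) +
        ((((P₂ ×ˢ ((X \ P₁) \ P₂)).filter fun pq => dist pq.1 pq.2 = 1).card : ℕ) : ℝ) ≤
        contactDeficiency ((X \ P₁) \ P₂) +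
          (Real.sqrt 2 / 4 * ∑ᶠ w ∈ {w ∈ fccStacking 1 (Real.sqrt (2 / 3)) | ‖w‖ = 1},
              |⟪w, A₁.symm (EuclideanSpace.single (2 : Fin 3) (1 : ℝ))⟫_ℝ| +
            Real.sqrt 2 / 4 * ∑ᶠ w ∈ {w ∈ fccStacking 1 (Real.sqrt (2 / 3)) | ‖w‖ = 1},
              |⟪w, A₂.symm (EuclideanSpace.single (2 : Fin 3) (1 : ℝ))⟫_ℝ| -
            Real.sqrt (1 - ⟪L (EuclideanSpace.single (2 : Fin 3) (1 : ℝ)),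
              EuclideanSpace.single (2 : Fin 3) (1 : ℝ)⟫_ℝ ^ 2) / (250000 * (1 + h))) * Real.pi * ρ ^ 2 +
          C * (1 + h) * ρ := by
  obtain ⟨w, hw, hw0, hwup, hflux⟩ := exists_inPlane_slot_of_coaxial_sharp A₁ t₁ L s₁ hσ hsub₁
  obtain ⟨C₁, hC₁⟩ := affineSampleDeficit_upper A₁ t₁ 10 (by norm_num)
  obtain ⟨C₂, hC₂⟩ := affineSampleDeficit_upper A₂ t₂ 10 (by norm_num)
  refine ⟨(240 * Real.sqrt 2 * Real.pi + 3120 * (4 * 10 + 2)) / 2 + 4 + |C₁| + |C₂|, 10, by norm_num, ?_⟩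
  intro h hh ρ hρ X P₁ P₂ hX hP₁X hP₂X hcell hP₁ hP₂
  set φ₁ : ℝ := Real.sqrt 2 / 4 * ∑ᶠ w ∈ {w ∈ fccStacking 1 (Real.sqrt (2 / 3)) | ‖w‖ = 1},
      |⟪w, A₁.symm (EuclideanSpace.single (2 : Fin 3) (1 : ℝ))⟫_ℝ| with hφ₁
  set φ₂ : ℝ := Real.sqrt 2 / 4 * ∑ᶠ w ∈ {w ∈ fccStacking 1 (Real.sqrt (2 / 3)) | ‖w‖ = 1},
      |⟪w, A₂.symm (EuclideanSpace.single (2 : Fin 3) (1 : ℝ))⟫_ℝ| with hφ₂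
  have hP₂X' : P₂ ⊆ X := hP₂X.trans Finset.sdiff_subset
  have hρ0 : (0 : ℝ) ≤ ρ := by linarith
  have hfloor : ∀ p ∈ X, -(2 * 10) ≤ p 2 := fun p hp => (hcell p hp).1
  have hLe₃ : ‖L (EuclideanSpace.single (2 : Fin 3) (1 : ℝ))‖ = 1 := by
    rw [LinearIsometryEquiv.norm_map, PiLp.norm_single, norm_one]
  have hAw : ‖A₁ w‖ = 1 := by rw [LinearIsometryEquiv.norm_map, norm_eq_one_of_mem_fccSlots hw]
  -- common: the two upper slab counts, the two splits, constants
  have hD₁ := hC₁ (-(2 * 10)) (-10) (by ring) ρ hρ P₁ hP₁; have hD₂ := hC₂ (h + 10) (h + 2 * 10) (by ring) ρ hρ P₂ hP₂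
  have hsplit₁ := contactDeficiency_sdiff_split hP₁X; have hsplit₂ := contactDeficiency_sdiff_split hP₂X
  have htwo := two_mul_contactDeficiency_eq_sum X
  have hb : C₁ * ρ ≤ |C₁| * (1 + h) * ρ := by
    have h1 : 0 ≤ (|C₁| - C₁) * ρ := mul_nonneg (by linarith only [le_abs_self C₁]) hρ0
    have h2 : 0 ≤ |C₁| * h * ρ := by positivity
    linarith only [h1, h2]
  have hc' : C₂ * ρ ≤ |C₂| * (1 + h) * ρ := by
    have h1 : 0 ≤ (|C₂| - C₂) * ρ := mul_nonneg (by linarith only [le_abs_self C₂]) hρ0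
    have h2 : 0 ≤ |C₂| * h * ρ := by positivity
    linarith only [h1, h2]
  have hhρ : 0 ≤ h * ρ := mul_nonneg hh hρ0
  -- the flux `f` and the sine `s`
  set f : ℝ := Real.sqrt 2 * |⟪A₁ w, EuclideanSpace.single (2 : Fin 3) (1 : ℝ)⟫_ℝ| with hf
  set s : ℝ := Real.sqrt (1 - ⟪L (EuclideanSpace.single (2 : Fin 3) (1 : ℝ)),
    EuclideanSpace.single (2 : Fin 3) (1 : ℝ)⟫_ℝ ^ 2) with hs
  have hf0 : 0 ≤ f := by positivity
  have hs0 : 0 ≤ s := Real.sqrt_nonneg _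
  have hs1 : s ≤ 1 := by
    have ht2 : 0 ≤ ⟪L (EuclideanSpace.single (2 : Fin 3) (1 : ℝ)), EuclideanSpace.single (2 : Fin 3) (1 : ℝ)⟫_ℝ ^ 2 :=
      sq_nonneg _
    calc s = Real.sqrt (1 - ⟪L (EuclideanSpace.single (2 : Fin 3) (1 : ℝ)),
        EuclideanSpace.single (2 : Fin 3) (1 : ℝ)⟫_ℝ ^ 2) := hs
      _ ≤ Real.sqrt 1 := Real.sqrt_le_sqrt (by linarith)
      _ = 1 := Real.sqrt_one
  have hsq6 : (2.449 : ℝ) ≤ Real.sqrt 6 := by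
    have := Real.sqrt_le_sqrt (show ((2.449 : ℝ)) ^ 2 ≤ 6 by norm_num); rwa [Real.sqrt_sq (by norm_num)] at this
  have hfs : 269594 * s ≤ 250000 * f := by
    have := mul_le_mul_of_nonneg_right hsq6 hs0; linarith
  have hs2 : Real.sqrt 2 ≤ 2 := by
    rw [show (2 : ℝ) = Real.sqrt (2 ^ 2) by rw [Real.sqrt_sq (by norm_num)]]
    exact Real.sqrt_le_sqrt (by norm_num)
  have hfle : f ≤ 2 := by
    have h1 := abs_inner_slot_le_one A₁ hw
    calc f = Real.sqrt 2 * |⟪A₁ w, EuclideanSpace.single (2 : Fin 3) (1 : ℝ)⟫_ℝ| := rfl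
      _ ≤ 2 * 1 := mul_le_mul hs2 h1 (abs_nonneg _) (by norm_num)
      _ = 2 := by ring
  have hπ : Real.pi ≤ 4 := Real.pi_le_four; have hπ0 : 0 ≤ Real.pi := Real.pi_pos.le
  have hsq : 0 ≤ Real.sqrt 2 := Real.sqrt_nonneg 2; have h1h : (0 : ℝ) < 1 + h := by linarith
  have hP0 : 0 ≤ Real.pi * ρ ^ 2 := by positivity
  -- the descent budget `K = ⌈3(h+23)⌉`
  obtain ⟨K, hKdef⟩ : ∃ K : ℕ, K = ⌈3 * (h + 23)⌉₊ := ⟨_, rfl⟩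
  have hK1 : 3 * (h + 23) ≤ K := by rw [hKdef]; exact Nat.le_ceil _
  have hK2 : (K : ℝ) < 3 * (h + 23) + 1 := by rw [hKdef]; exact Nat.ceil_lt_add_one (by positivity)
  have hK0 : (0 : ℝ) ≤ K := Nat.cast_nonneg K
  by_cases hbig : (K : ℝ) + 4 ≤ ρ
  · -- main branch: `ρ ≥ K + 4`
    -- the credited predicate: payers near inner located exits, or plate feet
    have hQc : ∀ e ∈ X, (e ∈ (fun q => A₁ q + t₁) '' fccStacking 1 (Real.sqrt (2 / 3)) ∧
        e 2 < h + 10 + 2 ∧ e 0 ^ 2 + e 1 ^ 2 ≤ (ρ - K - 3) ^ 2) → e - A₁ w ∈ X →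
        (∀ v ∈ fccSlots, e - A₁ w + A₁ v ∈ X) → e 2 < h + 12 := by
      intro e _ hQe _ _; have := hQe.2.1; linarith only [this]
    set EXI : Finset (EuclideanSpace ℝ (Fin 3)) := X.filter fun e =>
      (e ∈ (fun q => A₁ q + t₁) '' fccStacking 1 (Real.sqrt (2 / 3)) ∧
        e 2 < h + 10 + 2 ∧ e 0 ^ 2 + e 1 ^ 2 ≤ (ρ - K - 3) ^ 2) ∧
        e - A₁ w ∈ X ∧ (∀ v ∈ fccSlots, e - A₁ w + A₁ v ∈ X) ∧ ∃ v ∈ fccSlots, e + A₁ v ∉ X with hEXI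
    set FTCI : Finset (EuclideanSpace ℝ (Fin 3)) := EXI.filter fun e => ∃ n : EuclideanSpace ℝ (Fin 3), ‖n‖ = 1 ∧
        n ≠ L (EuclideanSpace.single (2 : Fin 3) (1 : ℝ)) ∧
        n ≠ -L (EuclideanSpace.single (2 : Fin 3) (1 : ℝ)) ∧
        (∀ v ∈ fccSlots, ⟪A₁ v, n⟫_ℝ = 0 ∨ ⟪A₁ v, n⟫_ℝ = Real.sqrt (2 / 3) ∨
          ⟪A₁ v, n⟫_ℝ = -Real.sqrt (2 / 3)) ∧
        ⟪A₁ w, n⟫_ℝ = Real.sqrt (2 / 3) ∧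
        (∀ v ∈ fccSlots, ⟪A₁ v, n⟫_ℝ ≤ 0 → e + A₁ v ∈ X) ∧
        (∀ v ∈ fccSlots, 0 < ⟪A₁ v, n⟫_ℝ → e + A₁ v ∉ X ∧ e - A₁ v + (2 * ⟪A₁ v, n⟫_ℝ) • n ∈ X)
      with hFTCI
    set EXS : Finset (EuclideanSpace ℝ (Fin 3)) := X.filter fun e =>
      (e ∈ (fun q => A₁ q + t₁) '' fccStacking 1 (Real.sqrt (2 / 3)) ∧
        e 2 < h + 10 + 2 ∧ e 0 ^ 2 + e 1 ^ 2 ≤ (ρ - 3) ^ 2) ∧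
        e - A₁ w ∈ X ∧ (∀ v ∈ fccSlots, e - A₁ w + A₁ v ∈ X) ∧ ∃ v ∈ fccSlots, e + A₁ v ∉ X with hEXS
    set ANN : Finset (EuclideanSpace ℝ (Fin 3)) := X.filter fun x =>
      (ρ - K - 3) ^ 2 < x 0 ^ 2 + x 1 ^ 2 ∧ x 0 ^ 2 + x 1 ^ 2 ≤ (ρ - 3) ^ 2 with hANN
    obtain ⟨PC, hPC⟩ : ∃ PC : EuclideanSpace ℝ (Fin 3) → Prop, ∀ y, PC y ↔
        ∃ e ∈ X, ((e ∈ (fun q => A₁ q + t₁) '' fccStacking 1 (Real.sqrt (2 / 3)) ∧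
          e 2 < h + 10 + 2 ∧ e 0 ^ 2 + e 1 ^ 2 ≤ (ρ - K - 3) ^ 2) ∧
          e - A₁ w ∈ X ∧ (∀ v ∈ fccSlots, e - A₁ w + A₁ v ∈ X) ∧ ∃ v ∈ fccSlots, e + A₁ v ∉ X) ∧
        (y = e ∨ dist e y = 1 ∨ (∃ z ∈ X, dist e z = 1 ∧ dist z y = 1) ∨
          ∃ z ∈ X, ∃ z' ∈ X, dist e z = 1 ∧ dist z z' = 1 ∧ dist z' y = 1) := ⟨_, fun _ => Iff.rfl⟩
    obtain ⟨FC, hFC⟩ : ∃ FC : EuclideanSpace ℝ (Fin 3) → Prop, ∀ z, FC z ↔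
        ∃ e ∈ X, e 2 < h + 10 + 2 ∧ ∃ uᵢ ∈ fccSlots, ∃ uⱼ ∈ fccSlots, ∃ k : ℕ, k ≤ K ∧
          (z = e + (k : ℝ) • A₁ (uᵢ - uⱼ) ∨ dist (e + (k : ℝ) • A₁ (uᵢ - uⱼ)) z = 1) ∧
          -10 - 2 < (e + (k : ℝ) • A₁ (uᵢ - uⱼ)) 2 ∧ (e + (k : ℝ) • A₁ (uᵢ - uⱼ)) 2 ≤ e 2 :=
      ⟨_, fun _ => Iff.rfl⟩
    set PAYI : Finset (EuclideanSpace ℝ (Fin 3)) := X.filter fun y =>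
      (X.filter fun q => dist y q = 1).card ≠ 12 ∧ PC y with hPAYI
    set FOOT : Finset (EuclideanSpace ℝ (Fin 3)) := X.filter fun z =>
      (X.filter fun q => dist z q = 1).card ≠ 12 ∧ FC z with hFOOT
    set CR : Finset (EuclideanSpace ℝ (Fin 3)) := X.filter fun y =>
      (X.filter fun q => dist y q = 1).card ≠ 12 ∧ (PC y ∨ FC y) with hCR
    -- interiority of the credited balls
    have hCr : ∀ y ∈ X, (PC y ∨ FC y) → y 0 ^ 2 + y 1 ^ 2 ≤ (ρ - 8) ^ 2 →
        -(2 * 10) + 1 ≤ y 2 ∧ y 2 ≤ h + 2 * 10 - 1 := by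
      intro y hyX hy hyr
      rcases hy with hpc | hfc
      · obtain ⟨e, heX, ⟨hQe, hpred, hfull, v, hv, hev⟩, hW⟩ := (hPC y).1 hpc
        refine ⟨?_, ?_⟩
        · by_contra hlow
          push Not at hlow
          exact hev (slots_full_of_near_bottom_layer_of_nonneg_sealed A₁ t₁ X P₁ 10 ρ (by norm_num) hρ hX hP₁X
            hfloor hP₁ hw hwup hpred hfull (by linarith only [hlow]) hyr (dist_le_three_of_withinThree hW) hv)
        · have := payer_height_lt A₁ (fun e => e ∈ (fun q => A₁ q + t₁) '' fccStacking 1 (Real.sqrt (2 / 3)) ∧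
              e 2 < h + 10 + 2 ∧ e 0 ^ 2 + e 1 ^ 2 ≤ (ρ - K - 3) ^ 2) (h + 12) hQc
            ⟨e, heX, ⟨hQe, hpred, hfull, v, hv, hev⟩, hW⟩
          linarith only [this]
      · obtain ⟨e, -, he2, uᵢ, -, uⱼ, -, k, -, hzy, hlo, hmono⟩ := (hFC y).1 hfc
        have hyz : |(e + (k : ℝ) • A₁ (uᵢ - uⱼ)) 2 - y 2| ≤ 1 := by
          rcases hzy with h0 | h1
          · rw [h0, sub_self, abs_zero]; norm_num
          · have := abs_apply_sub_le_dist (e + (k : ℝ) • A₁ (uᵢ - uⱼ)) y 2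
            rw [h1] at this; exact this
        obtain ⟨ha, hb'⟩ := abs_le.1 hyz
        exact ⟨by linarith only [hb', hlo], by linarith only [ha, hmono, he2]⟩
    -- the interior credit ledger
    have hled : 2 * φ₁ * Real.pi * ρ ^ 2 + 2 * φ₂ * Real.pi * ρ ^ 2 + ((CR.card : ℕ) : ℝ) -
        (240 * Real.sqrt 2 * Real.pi + 3120 * (4 * 10 + 2)) * (1 + h) * ρ ≤
        ∑ x ∈ X, ((12 : ℝ) - ((X.filter fun q => dist x q = 1).card : ℝ)) := by
      have h0 := interior_ledger_ge_faces_add_unsaturated A₁ t₁ A₂ t₂ X P₁ P₂ 10 h ρ le_rfl hh hρ hX hcell hP₁X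
        hP₂X' hP₁ hP₂ (fun y => PC y ∨ FC y) hCr
      rw [← finsum_unit_fcc_symm_eq_sum_slots A₁, ← finsum_unit_fcc_symm_eq_sum_slots A₂, ← hφ₁, ← hφ₂] at h0
      convert h0 using 7
    -- sources: all located exits, and the annulus
    have hEXSge : f * Real.pi * (ρ - 1) ^ 2 - 10 * Real.sqrt 2 * Real.pi * (ρ - 1) -
        30 * (h + 4 * 10 + 2) * (2 * ρ - 3) ≤ ((EXS.card : ℕ) : ℝ) := by
      have h0 := card_located_exits_ge A₁ t₁ A₂ t₂ hne X P₁ P₂ 10 h ρ (by norm_num) hh hρ hX hP₁X hP₂X' hcell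
        hP₁ hP₂ hw
      convert h0 using 3
    have hEXsplit : EXS.card ≤ EXI.card + ANN.card := by
      have hsub : EXS ⊆ EXI ∪ ANN := by
        intro e he
        rw [hEXS, mem_filter] at he
        obtain ⟨heX, ⟨heΛ, he2, her⟩, hrest⟩ := he
        rw [mem_union]
        by_cases hin : e 0 ^ 2 + e 1 ^ 2 ≤ (ρ - K - 3) ^ 2
        · exact Or.inl (by rw [hEXI, mem_filter]; exact ⟨heX, ⟨heΛ, he2, hin⟩, hrest⟩)
        · push Not at hin
          exact Or.inr (by rw [hANN, mem_filter]; exact ⟨heX, hin, her⟩)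
      exact (card_le_card hsub).trans (card_union_le _ _)
    have hANNle : ((ANN.card : ℕ) : ℝ) ≤ 12 * (h + 42) * (K + 2) * ρ := by
      have hsep : ∀ p ∈ ANN, ∀ q ∈ ANN, p ≠ q → 1 ≤ dist p q :=
        fun p hp q hq hpq => hX p (mem_filter.1 hp).1 q (mem_filter.1 hq).1 hpq
      have hmem : ∀ p ∈ ANN, -(2 * 10) ≤ p 2 ∧ p 2 ≤ h + 2 * 10 ∧ (ρ - K - 3) ^ 2 < p 0 ^ 2 + p 1 ^ 2 ∧
          p 0 ^ 2 + p 1 ^ 2 ≤ (ρ - 3) ^ 2 := by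
        intro p hp
        obtain ⟨hpX, h1, h2⟩ := mem_filter.1 hp
        exact ⟨(hcell p hpX).1, (hcell p hpX).2.1, h1, h2⟩
      have key := card_mul_le_of_separated_in_shell ANN hsep (-(2 * 10)) (h + 2 * 10) (ρ - K - 3) (ρ - 3)
        (by linarith only [hh]) (by linarith only [hbig]) (by linarith only [hK0]) hmem
      have e : (h + 2 * 10 - -(2 * 10) + 2) * (Real.pi * (ρ - 3 + 1) ^ 2 - Real.pi * (ρ - ↑K - 3 - 1) ^ 2) =
          (Real.pi / 6) * (6 * (h + 42) * ((K + 2) * (2 * ρ - K - 6))) := by ring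
      rw [e] at key
      have hπ6 : 0 < Real.pi / 6 := by positivity
      have h1 : (ANN.card : ℝ) ≤ 6 * (h + 42) * ((K + 2) * (2 * ρ - K - 6)) :=
        le_of_mul_le_mul_right (by linarith only [key]) hπ6
      have h2 : ((K : ℝ) + 2) * (2 * ρ - K - 6) ≤ (K + 2) * (2 * ρ) :=
        mul_le_mul_of_nonneg_left (by linarith only [hK0]) (by linarith only [hK0])
      have h3 : (0 : ℝ) ≤ 6 * (h + 42) := by linarith only [hh]
      have h4 := mul_le_mul_of_nonneg_left h2 h3
      have e5 : 6 * (h + 42) * ((↑K + 2) * (2 * ρ)) = 12 * (h + 42) * (↑K + 2) * ρ := by ring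
      linarith only [h1, h4, e5]
    -- sinks: inner exits pay or are foreign caps
    have hPAY : ((EXI.card : ℕ) : ℝ) ≤ ((FTCI.card : ℕ) : ℝ) + 1885 * ((PAYI.card : ℕ) : ℝ) := by
      have h0 := card_exits_le_restrict hg hc hX A₁ hw (fun e =>
        e ∈ (fun q => A₁ q + t₁) '' fccStacking 1 (Real.sqrt (2 / 3)) ∧
          e 2 < h + 10 + 2 ∧ e 0 ^ 2 + e 1 ^ 2 ≤ (ρ - K - 3) ^ 2)
      rw [filter_twinCapped_eq_foreign_of_inPlane A₁ L X _ hw0] at h0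
      have h1 : EXI.card ≤ FTCI.card + 1885 * PAYI.card := by
        convert h0 using 6
        exact hPC _
      exact_mod_cast h1
    -- foreign caps have feet
    have hFOOTle : FTCI.card ≤ 1872 * (K + 1) * FOOT.card := by
      refine card_le_of_foot_map_sep A₁ FTCI FOOT
        (fun p hp q hq hpq => hX p (mem_filter.1 (mem_filter.1 hp).1).1 q (mem_filter.1 (mem_filter.1 hq).1).1 hpq)
        K ?_
      intro e he
      rw [hFTCI, mem_filter] at he
      obtain ⟨heI, n, hn1, -, -, hmenu, hwn, hown, hfarmir⟩ := he
      rw [hEXI, mem_filter] at heI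
      obtain ⟨heX, ⟨heΛ, he2, her⟩, hpred, hfull, hlack⟩ := heI
      have hfar : ∀ v ∈ fccSlots, 0 < ⟪A₁ v, n⟫_ℝ → e + A₁ v ∉ X := fun v hv hp => (hfarmir v hv hp).1
      have hKρ : (0 : ℝ) ≤ ρ - K - 3 := by linarith only [hbig]
      have hmon : (ρ - K - 3) ^ 2 ≤ (ρ - 3) ^ 2 := by nlinarith only [hKρ, hK0]
      have her3 : e 0 ^ 2 + e 1 ^ 2 ≤ (ρ - 3) ^ 2 := her.trans hmon
      have he₂ : -(10 : ℝ) - 3 < e 2 := located_exit_height_gt A₁ t₁ X P₁ 10 ρ (by norm_num) hρ hX hP₁X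
        hfloor hP₁ hw hwup hpred hfull hlack her3
      have htilt := sqrt_two_thirds_le_tilt_add hAw hLe₃ hn1 hw0 hwn
      have hδ : (1 : ℝ) / 3 ≤ Real.sqrt 3 / 2 * Real.sqrt (1 - ⟪n, EuclideanSpace.single (2 : Fin 3) (1 : ℝ)⟫_ℝ ^ 2) :=
        third_le_descent_rate htilt hvic
      have hK : e 2 + 10 + 1 ≤ K * (1 / 3 : ℝ) := by linarith only [he2, hK1]
      obtain ⟨uᵢ, hi, uⱼ, hj, k, hk, z, hzX, hz12, hzy, hlo, hmono⟩ :=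
        twinDozen_plateFoot_payer hg hc A₁ t₁ X P₁ 10 ρ (by norm_num) hρ hX hP₁X hfloor hP₁ hn1 hmenu
          (by norm_num : (0 : ℝ) < 1 / 3) hδ heX he₂ hown hfar K hK her (by linarith only [hbig])
      refine ⟨z, ?_, uᵢ, hi, uⱼ, hj, k, hk, hzy⟩
      rw [hFOOT, mem_filter]
      exact ⟨hzX, hz12, (hFC z).2 ⟨e, heX, he2, uᵢ, hi, uⱼ, hj, k, hk, hzy, hlo, hmono⟩⟩
    have hsubP : PAYI.card ≤ CR.card := by
      refine card_le_card fun y hy => ?_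
      rw [hPAYI, mem_filter] at hy
      rw [hCR, mem_filter]
      exact ⟨hy.1, hy.2.1, Or.inl hy.2.2⟩
    have hsubF : FOOT.card ≤ CR.card := by
      refine card_le_card fun y hy => ?_
      rw [hFOOT, mem_filter] at hy
      rw [hCR, mem_filter]
      exact ⟨hy.1, hy.2.1, Or.inr hy.2.2⟩
    -- arithmetic
    set M : ℝ := 1872 * ((K : ℝ) + 1) + 1885 with hM
    have hMpos : 0 < M := by rw [hM]; positivity
    have hMle : M ≤ 134797 * (1 + h) := by rw [hM]; linarith only [hK2, hh]
    have hEXI' : ((EXI.card : ℕ) : ℝ) ≤ M * ((CR.card : ℕ) : ℝ) := by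
      have h1 : ((FTCI.card : ℕ) : ℝ) ≤ 1872 * ((K : ℝ) + 1) * ((FOOT.card : ℕ) : ℝ) := by exact_mod_cast hFOOTle
      have h2 : ((PAYI.card : ℕ) : ℝ) ≤ ((CR.card : ℕ) : ℝ) := by exact_mod_cast hsubP
      have h3 : ((FOOT.card : ℕ) : ℝ) ≤ ((CR.card : ℕ) : ℝ) := by exact_mod_cast hsubF
      have h4 : 1872 * ((K : ℝ) + 1) * ((FOOT.card : ℕ) : ℝ) ≤ 1872 * ((K : ℝ) + 1) * ((CR.card : ℕ) : ℝ) :=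
        mul_le_mul_of_nonneg_left h3 (by positivity)
      rw [hM]; linarith only [hPAY, h1, h2, h4]
    have hEXIlo : f * Real.pi * ρ ^ 2 - 2620 * (1 + h) * ρ - 12 * (h + 42) * (K + 2) * ρ ≤ ((EXI.card : ℕ) : ℝ) := by
      have hsplit' : ((EXS.card : ℕ) : ℝ) ≤ ((EXI.card : ℕ) : ℝ) + ((ANN.card : ℕ) : ℝ) := by
        exact_mod_cast hEXsplit
      have hkey : f * Real.pi * ρ ^ 2 - 2620 * (1 + h) * ρ ≤
          f * Real.pi * (ρ - 1) ^ 2 - 10 * Real.sqrt 2 * Real.pi * (ρ - 1) - 30 * (h + 4 * 10 + 2) * (2 * ρ - 3) := by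
        have e : f * Real.pi * (ρ - 1) ^ 2 - 10 * Real.sqrt 2 * Real.pi * (ρ - 1) -
            30 * (h + 4 * 10 + 2) * (2 * ρ - 3) - (f * Real.pi * ρ ^ 2 - 2620 * (1 + h) * ρ) =
            (2620 * ρ - 2 * (f * Real.pi * ρ) - 10 * (Real.sqrt 2 * Real.pi * ρ) - 2520 * ρ) +
              (2620 * (h * ρ) - 60 * (h * ρ)) + f * Real.pi + 10 * (Real.sqrt 2 * Real.pi) + 90 * h + 3780 := by
          ring
        have h2 : 0 ≤ Real.sqrt 2 * Real.pi := mul_nonneg hsq hπ0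
        have h3 : f * Real.pi * ρ ≤ 8 * ρ := by
          have : f * Real.pi ≤ 8 := by nlinarith only [hfle, hπ, hπ0, hf0]
          exact mul_le_mul_of_nonneg_right this hρ0
        have h4 : Real.sqrt 2 * Real.pi * ρ ≤ 8 * ρ := by
          have : Real.sqrt 2 * Real.pi ≤ 8 := by nlinarith only [hs2, hπ, hπ0, hsq]
          exact mul_le_mul_of_nonneg_right this hρ0
        have h5 : 0 ≤ f * Real.pi := mul_nonneg hf0 hπ0
        linarith only [e, hhρ, h2, h3, h4, h5, hh, hρ0]
      linarith only [hEXSge, hANNle, hsplit', hkey]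
    -- the credit in the goal's currency
    have hCRlo : (f * Real.pi * ρ ^ 2 - (2620 * (1 + h) * ρ + 12 * (h + 42) * (K + 2) * ρ)) / M ≤
        ((CR.card : ℕ) : ℝ) := by
      rw [div_le_iff₀ hMpos]; linarith only [hEXI', hEXIlo]
    have hsplitdiv : (f * Real.pi * ρ ^ 2 - (2620 * (1 + h) * ρ + 12 * (h + 42) * (K + 2) * ρ)) / M =
        f * Real.pi * ρ ^ 2 / M - (2620 * (1 + h) * ρ + 12 * (h + 42) * (K + 2) * ρ) / M := sub_div _ _ _
    have hjunk : (2620 * (1 + h) * ρ + 12 * (h + 42) * (K + 2) * ρ) / M ≤ 4 * (1 + h) * ρ := by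
      rw [div_le_iff₀ hMpos, hM]
      have h1 : h + 42 ≤ 42 * (1 + h) := by linarith only [hh]
      have h2 : (0 : ℝ) ≤ 12 * (K + 2) * ρ := by positivity
      have h3 := mul_le_mul_of_nonneg_left h1 h2
      have h4 : 0 ≤ h * ρ := hhρ
      have h5 : (0 : ℝ) ≤ K * ρ := by positivity
      have h6 : (0 : ℝ) ≤ h * K * ρ := by positivity
      have e7 : 12 * (h + 42) * (↑K + 2) * ρ = 12 * (↑K + 2) * ρ * (h + 42) := by ring
      have e8 : 12 * (↑K + 2) * ρ * (42 * (1 + h)) = 504 * (K * ρ) + 504 * (h * K * ρ) + 1008 * ρ + 1008 * (h * ρ) := by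
        ring
      have e9 : 4 * (1 + h) * ρ * (1872 * (↑K + 1) + 1885) =
          7488 * (K * ρ) + 7488 * (h * K * ρ) + 15028 * ρ + 15028 * (h * ρ) := by ring
      have e10 : 2620 * (1 + h) * ρ = 2620 * ρ + 2620 * (h * ρ) := by ring
      linarith only [h3, h4, h5, h6, e7, e8, e9, e10, hρ0]
    have hcharge : s / (250000 * (1 + h)) * Real.pi * ρ ^ 2 ≤ f * Real.pi * ρ ^ 2 / M / 2 := by
      have e1 : s / (250000 * (1 + h)) * Real.pi * ρ ^ 2 = s * (Real.pi * ρ ^ 2) / (250000 * (1 + h)) := by ring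
      have e2 : f * Real.pi * ρ ^ 2 / M / 2 = f * (Real.pi * ρ ^ 2) / (2 * M) := by
        rw [div_div]; ring
      rw [e1, e2, div_le_iff₀ (by positivity), div_mul_eq_mul_div, le_div_iff₀ (by positivity)]
      -- `s P (2M) ≤ f P 250000 (1+h)`
      have h1 : s * (2 * M) ≤ 250000 * (1 + h) * f := by
        have a1 := mul_le_mul_of_nonneg_left hMle (by positivity : (0 : ℝ) ≤ 2 * s)
        have a2 := mul_le_mul_of_nonneg_left hfs h1h.le
        have e3 : 2 * s * (134797 * (1 + h)) = 269594 * s * (1 + h) := by ring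
        have e4 : (1 + h) * (250000 * f) = 250000 * (1 + h) * f := by ring
        have e5 : (1 + h) * (269594 * s) = 269594 * s * (1 + h) := by ring
        have e6 : 2 * s * M = s * (2 * M) := by ring
        linarith only [a1, a2, e3, e4, e5, e6]
      have h2 := mul_le_mul_of_nonneg_left h1 hP0
      have e7 : Real.pi * ρ ^ 2 * (s * (2 * M)) = s * (Real.pi * ρ ^ 2) * (2 * M) := by ring
      have e8 : Real.pi * ρ ^ 2 * (250000 * (1 + h) * f) = f * (Real.pi * ρ ^ 2) * (250000 * (1 + h)) := by ring
      linarith only [h2, e7, e8]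
    linarith only [hled, hCRlo, hsplitdiv, hjunk, hcharge, hD₁, hD₂, hsplit₁, hsplit₂, htwo, hb, hc', hρ0, hh, hhρ]
  · -- small cells
    push Not at hbig
    have hled : 2 * φ₁ * Real.pi * ρ ^ 2 + 2 * φ₂ * Real.pi * ρ ^ 2 +
        (((X.filter fun y => (X.filter fun q => dist y q = 1).card ≠ 12 ∧ False).card : ℕ) : ℝ) -
        (240 * Real.sqrt 2 * Real.pi + 3120 * (4 * 10 + 2)) * (1 + h) * ρ ≤
        ∑ x ∈ X, ((12 : ℝ) - ((X.filter fun q => dist x q = 1).card : ℝ)) := by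
      have h0 := interior_ledger_ge_faces_add_unsaturated A₁ t₁ A₂ t₂ X P₁ P₂ 10 h ρ le_rfl hh hρ hX hcell hP₁X
        hP₂X' hP₁ hP₂ (fun _ => False) (fun y _ hf _ => hf.elim)
      rw [← finsum_unit_fcc_symm_eq_sum_slots A₁, ← finsum_unit_fcc_symm_eq_sum_slots A₂, ← hφ₁, ← hφ₂] at h0
      convert h0 using 7
    have hCR0 : (0 : ℝ) ≤ (((X.filter fun y => (X.filter fun q => dist y q = 1).card ≠ 12 ∧ False).card : ℕ) : ℝ) :=
      Nat.cast_nonneg _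
    have hsmall : s / (250000 * (1 + h)) * Real.pi * ρ ^ 2 ≤ (1 + h) * ρ := by
      have e1 : s / (250000 * (1 + h)) * Real.pi * ρ ^ 2 = s * Real.pi * ρ * ρ / (250000 * (1 + h)) := by ring
      rw [e1, div_le_iff₀ (by positivity)]
      have hρle : ρ < 3 * (h + 23) + 1 + 4 := by linarith only [hbig, hK2]
      have h1 : s * Real.pi ≤ 4 := by
        have := mul_le_mul hs1 hπ hπ0 (by norm_num : (0:ℝ) ≤ 1)
        linarith only [this]
      have h2 : s * Real.pi * ρ * ρ ≤ 4 * ρ * ρ := by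
        have := mul_le_mul_of_nonneg_right (mul_le_mul_of_nonneg_right h1 hρ0) hρ0
        linarith only [this]
      have h3 : ρ * ρ ≤ ρ * (3 * h + 74) := mul_le_mul_of_nonneg_left (by linarith only [hρle]) hρ0
      have h4 : 4 * ρ * ρ ≤ 4 * (ρ * (3 * h + 74)) := by linarith only [h3]
      have e5 : (1 + h) * ρ * (250000 * (1 + h)) = 250000 * ρ + 500000 * (h * ρ) + 250000 * (h * h * ρ) := by ring
      have h6 : 0 ≤ h * h * ρ := by positivity
      have e7 : 4 * (ρ * (3 * h + 74)) = 12 * (h * ρ) + 296 * ρ := by ring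
      linarith only [h2, h4, e5, h6, e7, hρ0, hhρ]
    linarith only [hled, hCR0, hsmall, hD₁, hD₂, hsplit₁, hsplit₂, htwo, hb, hc', hρ0, hh, hhρ]

end Summit.Ventures.Crystal3D.Theorems

end
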